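import Literature.AnabelianGeometry.EtaleTheta.Discharge.Sec2InversionProofs
import Literature.AnabelianGeometry.EtaleTheta.Discharge.Sec2ClassTwoCommutators
import Mathlib.Data.ZMod.QuotientGroup

/-!
# [EtTh] §2: the commutator pairing on `Δ̄_X` ("the well-known structure of the theta group")
# and its consequences for Remark 2.6.1 — `Δ̄_Θ` cyclic, non-degeneracy (proof-only companion)

Mochizuki, *The Étale Theta Function …* [EtTh], Publ. RIMS 45 (2009), §1 p.12 and §2 p.35 (PRIMS
text, locators = PDF pages; bib key `MochizukiEtTh2009`): "`Δ^Θ_X := Δ_X/[Δ_X,[Δ_X,Δ_X]]` … we write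
`Δ_Θ` for the image of `∧² Δ^ab_X` in `Δ^Θ_X`", "`Δ̄_X` for the quotient of `Δ^Θ_X` by [l-th powers]
… `1 → Δ̄_Θ → Δ̄_X → Δ̄^ell_X → 1` — where `Δ̄_Θ ≅ (ℤ/lℤ)(1)`; `Δ̄^ell_X` is a free `(ℤ/lℤ)`-module of
rank `2`" [cite: MochizukiEtTh2009, Def 2.1 p.35]; the commutator calculus is Witt–Hall
(Magnus–Karrass–Solitar Thm 5.1, the tree's `Discharge/Sec2ClassTwoCommutators.lean`).

Cell abc-iut, layer L2, discharge seat abc-iut-L2-d3 (nodes EtTh:Rmk2.6.1, EtTh:Cor2.9), companion of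
seat abc-iut-L2-t2's `ThetaCovers.lean` / `ThetaCoversAxioms.lean`. The interface `CoverDataAx` records
`Δ̄_Θ` (the field `barTheta`, inverse image in `Π_C`) only through `[Δ̄_Θ-preimage : Ker] = l`,
`Δ̄_Θ` central, `Δ_X/Δ̄_Θ-preimage ≅ (ℤ/lℤ)²`; it does NOT record the printed DEFINITION of `Δ_Θ` as the
image of the commutators (p.12/p.35). That printed sentence is carried here as the explicit
hypothesis

  `(hΘ : ⁅X.DeltaX, X.DeltaX⁆ ⊔ X.barKer = X.barTheta)` — "`Δ̄_Θ = Im(∧² Δ̄^ell_X) = [Δ̄_X, Δ̄_X]`",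

(FINDING reported to the interface owner: without it the interface admits models with `Δ̄_X`
abelian, for which Remark 2.6.1 fails) and we PROVE from it:

* `commutator_deltaX_le_barTheta`, `commutator_deltaX_barTheta_le_barKer` — `Δ̄_X` is of class two:
  `[Δ_X, Δ_X] ⊆ Δ̄_Θ`-preimage, `[Δ_X, Δ̄_Θ-preimage] ⊆ Ker` (from the interface, no `hΘ`);
* `exists_generators` — `Δ_X = u^ℤ · g^ℤ · (Δ̄_Θ-preimage)` with `g ∈ Δ_{X̲}` (for `Π_{X̲}` of type
  `(1, l-tors)`), `u ↦ 1 ∈ Q = Π_X/Π_{X̲} ≅ ℤ/lℤ`;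
* `map_barTheta_eq_zpowers`, `orderOf_commutator_eq` (under `hΘ`) — the image of `Δ̄_Θ`-preimage in
  `Π_C/Ker` is the cyclic group generated by the commutator `[u, g]`, of order `l`: **`Δ̄_Θ ≅ ℤ/lℤ`**
  (`nonempty_barTheta_quot_mulEquiv_zmod`);
* `mem_of_commutator_mem_barKer` (under `hΘ`) — **non-degeneracy**: an element of `Δ_X` commuting with
  `Δ_{X̲}` modulo `Ker` lies in `Δ_{X̲}` (the centraliser of the "`(−1)`-eigenline" is that line times the
  centre) — the step "one computes easily" of Rmk 2.6.1 for `Aut_K(X̲̲)`.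

No new definition, no named fact; nothing asserts that a `CoverDataAx` exists; no side is taken on any
disputed claim.
-/

namespace Literature.AnabelianGeometry.EtaleTheta

namespace ThetaCovers

namespace CoverDataAx

open scoped commutatorElement

universe u

variable {l : ℕ} (X : CoverDataAx.{u} l)

/-! ### `Δ̄_X` is of nilpotency class two -/

/-- `[Δ_X, Δ_X] ⊆ Δ̄_Θ`-preimage: `Δ_X/Δ̄_Θ-preimage ≅ (ℤ/lℤ)²` is abelian (`ell_rank_two`).
[cite: MochizukiEtTh2009, Def 2.1 p.35] -/
theorem commutator_deltaX_le_barTheta : ⁅X.DeltaX, X.DeltaX⁆ ≤ X.barTheta := by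
  haveI : (X.barTheta.subgroupOf X.DeltaX).Normal := X.barTheta_normal.subgroupOf _
  obtain ⟨e⟩ := X.ell_rank_two
  rw [Subgroup.commutator_le]
  intro x hx y hy
  let ψ : X.DeltaX →* Multiplicative (ZMod l × ZMod l) :=
    e.toMonoidHom.comp (QuotientGroup.mk' (X.barTheta.subgroupOf X.DeltaX))
  have hψ : ∀ d : X.DeltaX, ψ d = 1 ↔ (d : X.PiC) ∈ X.barTheta := by
    intro d
    change e (QuotientGroup.mk d) = 1 ↔ _
    rw [← map_one e, e.injective.eq_iff, QuotientGroup.eq_one_iff, Subgroup.mem_subgroupOf]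
  have h1 : ψ ⁅(⟨x, hx⟩ : X.DeltaX), ⟨y, hy⟩⁆ = 1 := by
    rw [map_commutatorElement, commutatorElement_eq_one_iff_mul_comm, mul_comm]
  have h2 := (hψ _).mp h1
  simpa [commutatorElement_def] using h2

/-- `[Δ_X, Δ̄_Θ-preimage] ⊆ Ker(Δ_X ↠ Δ̄_X)`: `Δ̄_Θ` is central in `Δ̄_X` (`barTheta_central`).
[cite: MochizukiEtTh2009, Def 2.1 p.35] -/
theorem commutator_deltaX_barTheta_le_barKer : ⁅X.DeltaX, X.barTheta⁆ ≤ X.barKer := by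
  rw [Subgroup.commutator_le]
  intro d hd t ht
  have h := X.barTheta_central t ht d hd
  have : ⁅d, t⁆ = (t * d * t⁻¹ * d⁻¹)⁻¹ := by simp only [commutatorElement_def]; group
  rw [this]
  exact Subgroup.inv_mem _ h

/-- The pairing kills `Δ̄_Θ`-preimage on the right: `[d, t] ∈ Ker` for `d ∈ Δ_X`, `t ∈ Δ̄_Θ`-preimage.
[cite: MochizukiEtTh2009, Def 2.1 p.35] -/
theorem mk_commutator_barTheta_right {d t : X.PiC} (hd : d ∈ X.DeltaX) (ht : t ∈ X.barTheta) :
    haveI := X.barKer_normal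
    ((⁅d, t⁆ : X.PiC) : X.PiC ⧸ X.barKer) = 1 := by
  haveI := X.barKer_normal
  rw [QuotientGroup.eq_one_iff]
  exact X.commutator_deltaX_barTheta_le_barKer (Subgroup.commutator_mem_commutator hd ht)

/-- … and on the left. [cite: MochizukiEtTh2009, Def 2.1 p.35] -/
theorem mk_commutator_barTheta_left {t d : X.PiC} (ht : t ∈ X.barTheta) (hd : d ∈ X.DeltaX) :
    haveI := X.barKer_normal
    ((⁅t, d⁆ : X.PiC) : X.PiC ⧸ X.barKer) = 1 := by
  haveI := X.barKer_normal
  rw [← commutatorElement_inv, QuotientGroup.mk_inv, X.mk_commutator_barTheta_right hd ht, inv_one]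

/-! ### Generators of `Δ_X` modulo `Δ̄_Θ`: `u` (a unit of `Q`) and `g` (a generator of `Δ_{X̲}`) -/

/-- For `Π_{X̲} = H` of type `(1, l-tors)` with quotient map `φ : Π_X ↠ Q ≅ ℤ/lℤ`: there is `u ∈ Δ_X`
with `φ(u) = 1 ∈ ℤ/lℤ` ("the restricted map `Δ̄^ell_X → Q` is still surjective", Def 2.1), and then every
`d ∈ Δ_X` is `u^n · d'` with `d' ∈ Δ_{X̲} = H ∩ Δ_X`, `φ(d) = n`. [cite: MochizukiEtTh2009, Def 2.1 p.36] -/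
theorem exists_unit {H : Subgroup X.PiC} (hT : X.toCoverData.IsTypeLTors H)
    (φ : X.PiX →* Multiplicative (ZMod l)) (hφs : Function.Surjective φ)
    (hφk : ∀ g : X.PiX, φ g = 1 ↔ (g : X.PiC) ∈ H) :
    ∃ u : X.PiC, ∃ hu : u ∈ X.DeltaX, φ ⟨u, hu.1⟩ = Multiplicative.ofAdd 1 ∧
      ∀ d : X.PiC, ∀ hd : d ∈ X.DeltaX, ∃ (n : ℕ) (d' : X.PiC), d' ∈ H ∧ d' ∈ X.DeltaX ∧
        d = u ^ n * d' ∧ φ ⟨d, hd.1⟩ = Multiplicative.ofAdd (n : ZMod l) := by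
  haveI := X.PiX_normal
  haveI : X.DeltaX.Normal := inferInstance
  haveI : NeZero l := ⟨by obtain ⟨k, hk⟩ := X.l_odd; omega⟩
  obtain ⟨p, hp⟩ := hφs (Multiplicative.ofAdd 1)
  have hp' : (p : X.PiC) ∈ H ⊔ X.DeltaX := by rw [hT.delta_sup]; exact p.2
  obtain ⟨h, hh, u, hu, hhu⟩ := Subgroup.mem_sup_of_normal_right.mp hp'
  have hφu : φ ⟨u, hu.1⟩ = Multiplicative.ofAdd 1 := by
    have hhX : h ∈ X.PiX := hT.le hh
    have h1 : φ ⟨h, hhX⟩ = 1 := (hφk ⟨h, hhX⟩).mpr hh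
    have hpd : p = ⟨h, hhX⟩ * ⟨u, hu.1⟩ := Subtype.ext hhu.symm
    rw [hpd, map_mul, h1, one_mul] at hp
    exact hp
  refine ⟨u, hu, hφu, fun d hd => ?_⟩
  set n : ℕ := (Multiplicative.toAdd (φ ⟨d, hd.1⟩)).val with hn
  have hφd : φ ⟨d, hd.1⟩ = Multiplicative.ofAdd (n : ZMod l) := by
    rw [hn, ZMod.natCast_zmod_val, ofAdd_toAdd]
  have hφun : φ (⟨u, hu.1⟩ ^ n) = Multiplicative.ofAdd (n : ZMod l) := by
    rw [map_pow, hφu, ← ofAdd_nsmul, nsmul_one]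
  refine ⟨n, (u ^ n)⁻¹ * d, ?_, ?_, ?_, hφd⟩
  · have : φ ((⟨u, hu.1⟩ ^ n)⁻¹ * ⟨d, hd.1⟩) = 1 := by
      rw [map_mul, map_inv, hφun, hφd, inv_mul_cancel]
    exact (hφk _).mp this
  · exact Subgroup.mul_mem _ (Subgroup.inv_mem _ (Subgroup.pow_mem _ hu n)) hd
  · rw [mul_inv_cancel_left]

/-- **Generators of `Δ_X` modulo `Δ̄_Θ`-preimage**: `u` as in `exists_unit` and a generator `g` of the
cyclic group `Δ_{X̲}/Δ̄_Θ` (`exists_generator_mod_barTheta`, Prop 2.2: "`Δ̄^ell_{X̲}` … is a cyclic group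
of order `l`"): every `d ∈ Δ_X` is `u^n · g^k · t` with `t ∈ Δ̄_Θ`-preimage and `φ(d) = n`.
[cite: MochizukiEtTh2009, Prop 2.2(ii) p.37] -/
theorem exists_generators {H : Subgroup X.PiC} (hT : X.toCoverData.IsTypeLTors H)
    (φ : X.PiX →* Multiplicative (ZMod l)) (hφs : Function.Surjective φ)
    (hφk : ∀ g : X.PiX, φ g = 1 ↔ (g : X.PiC) ∈ H) :
    ∃ u g : X.PiC, ∃ hu : u ∈ X.DeltaX, g ∈ H ∧ g ∈ X.DeltaX ∧
      φ ⟨u, hu.1⟩ = Multiplicative.ofAdd 1 ∧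
      ∀ d : X.PiC, ∀ hd : d ∈ X.DeltaX, ∃ (n : ℕ) (k : ℤ) (t : X.PiC), t ∈ X.barTheta ∧
        d = u ^ n * (g ^ k * t) ∧ φ ⟨d, hd.1⟩ = Multiplicative.ofAdd (n : ZMod l) := by
  obtain ⟨u, hu, hφu, hdec⟩ := X.exists_unit hT φ hφs hφk
  obtain ⟨g, hgH, hgΔ, hgen⟩ := X.exists_generator_mod_barTheta hT
  refine ⟨u, g, hu, hgH, hgΔ, hφu, fun d hd => ?_⟩
  obtain ⟨n, d', hd'H, hd'Δ, hdd', hφd⟩ := hdec d hd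
  obtain ⟨k, t, ht, hd't⟩ := hgen d' hd'H hd'Δ
  exact ⟨n, k, t, ht, by rw [hdd', hd't], hφd⟩

/-! ### The pairing against the generators -/

section Pairing

variable {H : Subgroup X.PiC} {u g : X.PiC}

/-- `[x, g^k t] ≡ [x, g]^k` modulo `Ker`, for `x, g ∈ Δ_X`, `t ∈ Δ̄_Θ`-preimage (bilinearity in the second
slot). [cite: MochizukiEtTh2009, Def 2.1 p.35] -/
theorem mk_commutator_gen_right {x : X.PiC} (hx : x ∈ X.DeltaX) (hg : g ∈ X.DeltaX) (k : ℤ)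
    {t : X.PiC} (ht : t ∈ X.barTheta) :
    haveI := X.barKer_normal
    ((⁅x, g ^ k * t⁆ : X.PiC) : X.PiC ⧸ X.barKer) = (((⁅x, g⁆ : X.PiC) : X.PiC ⧸ X.barKer)) ^ k := by
  haveI := X.barKer_normal
  have hAA := X.commutator_deltaX_le_barTheta
  have hAK := X.commutator_deltaX_barTheta_le_barKer
  rw [ClassTwo.mk_commutator_mul_right X.DeltaX X.barTheta X.barKer hAA hAK hx
      (Subgroup.zpow_mem _ hg k) (X.barTheta_le ht),
    X.mk_commutator_barTheta_right hx ht, mul_one,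
    ClassTwo.mk_commutator_zpow_right X.DeltaX X.barTheta X.barKer hAA hAK hx hg k]

/-- `[u^n (g^k t), y] ≡ [u, y]^n [g, y]^k` modulo `Ker` (bilinearity in the first slot).
[cite: MochizukiEtTh2009, Def 2.1 p.35] -/
theorem mk_commutator_gen_left (hu : u ∈ X.DeltaX) (hg : g ∈ X.DeltaX) (n : ℕ) (k : ℤ)
    {t y : X.PiC} (ht : t ∈ X.barTheta) (hy : y ∈ X.DeltaX) :
    haveI := X.barKer_normal
    ((⁅u ^ n * (g ^ k * t), y⁆ : X.PiC) : X.PiC ⧸ X.barKer) =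
      (((⁅u, y⁆ : X.PiC) : X.PiC ⧸ X.barKer)) ^ n * (((⁅g, y⁆ : X.PiC) : X.PiC ⧸ X.barKer)) ^ k := by
  haveI := X.barKer_normal
  have hAA := X.commutator_deltaX_le_barTheta
  have hAK := X.commutator_deltaX_barTheta_le_barKer
  have hK := X.barTheta_le
  have hgkt : g ^ k * t ∈ X.DeltaX := Subgroup.mul_mem _ (Subgroup.zpow_mem _ hg k) (hK ht)
  rw [ClassTwo.mk_commutator_mul_left X.DeltaX X.barTheta X.barKer hAA hK hAK
      (Subgroup.pow_mem _ hu n) hgkt hy,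
    ClassTwo.mk_commutator_mul_left X.DeltaX X.barTheta X.barKer hAA hK hAK
      (Subgroup.zpow_mem _ hg k) (hK ht) hy,
    X.mk_commutator_barTheta_left ht hy, mul_one,
    ← zpow_natCast, ClassTwo.mk_commutator_zpow_left X.DeltaX X.barTheta X.barKer hAA hK hAK hu hy,
    ClassTwo.mk_commutator_zpow_left X.DeltaX X.barTheta X.barKer hAA hK hAK hg hy, zpow_natCast]

/-- With generators `u, g` as in `exists_generators` and `c := [u, g] mod Ker`: every commutator of
`Δ_X` is a power of `c` modulo `Ker` — `[u, d] = c^k`, `[g, d] = c^{−n}` for `d = u^n g^k t`.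
[cite: MochizukiEtTh2009, Def 2.1 p.35] -/
theorem mk_commutator_mem_zpowers (hu : u ∈ X.DeltaX) (hg : g ∈ X.DeltaX)
    (hdec : ∀ d : X.PiC, d ∈ X.DeltaX → ∃ (n : ℕ) (k : ℤ) (t : X.PiC), t ∈ X.barTheta ∧
      d = u ^ n * (g ^ k * t))
    {x y : X.PiC} (hx : x ∈ X.DeltaX) (hy : y ∈ X.DeltaX) :
    haveI := X.barKer_normal
    ((⁅x, y⁆ : X.PiC) : X.PiC ⧸ X.barKer) ∈
      Subgroup.zpowers (((⁅u, g⁆ : X.PiC) : X.PiC ⧸ X.barKer)) := by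
  haveI := X.barKer_normal
  set c : X.PiC ⧸ X.barKer := ((⁅u, g⁆ : X.PiC) : X.PiC ⧸ X.barKer) with hc
  -- the values `[u, y]`, `[g, y]` for `y = u^n' g^k' t'`
  have key : ∀ {y : X.PiC}, y ∈ X.DeltaX →
      ((⁅u, y⁆ : X.PiC) : X.PiC ⧸ X.barKer) ∈ Subgroup.zpowers c ∧
      ((⁅g, y⁆ : X.PiC) : X.PiC ⧸ X.barKer) ∈ Subgroup.zpowers c := by
    intro y hy
    obtain ⟨n', k', t', ht', rfl⟩ := hdec y hy
    have e1 : ((⁅u, u ^ n' * (g ^ k' * t')⁆ : X.PiC) : X.PiC ⧸ X.barKer) = c ^ k' := by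
      rw [← commutatorElement_inv, QuotientGroup.mk_inv,
        X.mk_commutator_gen_left hu hg n' k' ht' hu, commutatorElement_self, QuotientGroup.mk_one,
        one_pow, one_mul, ← commutatorElement_inv, QuotientGroup.mk_inv, ← hc, inv_zpow, inv_inv]
    have e2 : ((⁅g, u ^ n' * (g ^ k' * t')⁆ : X.PiC) : X.PiC ⧸ X.barKer) = (c ^ (n' : ℤ))⁻¹ := by
      rw [← commutatorElement_inv, QuotientGroup.mk_inv,
        X.mk_commutator_gen_left hu hg n' k' ht' hg, commutatorElement_self, QuotientGroup.mk_one,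
        one_zpow, mul_one, ← hc, zpow_natCast]
    refine ⟨?_, ?_⟩
    · rw [e1]; exact Subgroup.zpow_mem _ (Subgroup.mem_zpowers c) k'
    · rw [e2]; exact Subgroup.inv_mem _ (Subgroup.zpow_mem _ (Subgroup.mem_zpowers c) n')
  obtain ⟨n, k, t, ht, rfl⟩ := hdec x hx
  rw [X.mk_commutator_gen_left hu hg n k ht hy]
  exact Subgroup.mul_mem _ (Subgroup.pow_mem _ (key hy).1 n) (Subgroup.zpow_mem _ (key hy).2 k)

end Pairing

/-! ### Consequences of `Δ̄_Θ = [Δ̄_X, Δ̄_X]`: `Δ̄_Θ` is cyclic of order `l` -/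

/-- The image of `Δ̄_Θ`-preimage in `Π_C/Ker` has `l` elements (`[Δ̄_Θ-preimage : Ker] = l`).
[cite: MochizukiEtTh2009, Def 2.1 p.35] -/
theorem card_map_barTheta :
    haveI := X.barKer_normal
    Nat.card (X.barTheta.map (QuotientGroup.mk' X.barKer)) = l := by
  haveI := X.barKer_normal
  let f : X.barTheta →* X.PiC ⧸ X.barKer := (QuotientGroup.mk' X.barKer).comp X.barTheta.subtype
  have hrange : f.range = X.barTheta.map (QuotientGroup.mk' X.barKer) := by
    rw [MonoidHom.range_comp, Subgroup.range_subtype]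
  have hker : f.ker = X.barKer.subgroupOf X.barTheta := by
    ext t
    rw [MonoidHom.mem_ker, Subgroup.mem_subgroupOf]
    exact QuotientGroup.eq_one_iff (t : X.PiC)
  rw [← hrange, ← Subgroup.index_ker, hker]
  exact X.relIndex_barKer

/-- Under `hΘ : [Δ_X, Δ_X]·Ker = Δ̄_Θ`-preimage and generators `u, g` of `Δ_X` modulo `Δ̄_Θ`: the image of
`Δ̄_Θ`-preimage in `Π_C/Ker` is the cyclic group generated by `c = [u, g]`.
[cite: MochizukiEtTh2009, Def 2.1 p.35] -/
theorem map_barTheta_eq_zpowers (hΘ : ⁅X.DeltaX, X.DeltaX⁆ ⊔ X.barKer = X.barTheta)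
    {u g : X.PiC} (hu : u ∈ X.DeltaX) (hg : g ∈ X.DeltaX)
    (hdec : ∀ d : X.PiC, d ∈ X.DeltaX → ∃ (n : ℕ) (k : ℤ) (t : X.PiC), t ∈ X.barTheta ∧
      d = u ^ n * (g ^ k * t)) :
    haveI := X.barKer_normal
    X.barTheta.map (QuotientGroup.mk' X.barKer) =
      Subgroup.zpowers (((⁅u, g⁆ : X.PiC) : X.PiC ⧸ X.barKer)) := by
  haveI := X.barKer_normal
  refine le_antisymm ?_ ?_
  · rw [← hΘ, Subgroup.map_sup, sup_le_iff]
    refine ⟨?_, ?_⟩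
    · rw [Subgroup.map_commutator, Subgroup.commutator_le]
      rintro _ ⟨x, hx, rfl⟩ _ ⟨y, hy, rfl⟩
      rw [← map_commutatorElement]
      exact X.mk_commutator_mem_zpowers hu hg hdec hx hy
    · rw [(Subgroup.map_eq_bot_iff _).mpr (by rw [QuotientGroup.ker_mk'])]
      exact bot_le
  · rw [Subgroup.zpowers_le]
    exact ⟨⁅u, g⁆, X.commutator_deltaX_le_barTheta (Subgroup.commutator_mem_commutator hu hg), rfl⟩

/-- **`Δ̄_Θ ≅ ℤ/lℤ`** ("`Δ̄_Θ ≅ (ℤ/lℤ)(1)`", p.35) — PROVED from `hΘ : [Δ_X, Δ_X]·Ker = Δ̄_Θ`-preimage (given a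
`Π_{X̲}` of type `(1, l-tors)` to name generators): `Δ̄_Θ`-preimage`/Ker` is cyclic of order `l`.
[cite: MochizukiEtTh2009, Def 2.1 p.35] -/
theorem nonempty_barTheta_quot_mulEquiv (hΘ : ⁅X.DeltaX, X.DeltaX⁆ ⊔ X.barKer = X.barTheta)
    {H : Subgroup X.PiC} (hT : X.toCoverData.IsTypeLTors H) :
    haveI : (X.barKer.subgroupOf X.barTheta).Normal := X.barKer_normal.subgroupOf _
    Nonempty (↥X.barTheta ⧸ X.barKer.subgroupOf X.barTheta ≃* Multiplicative (ZMod l)) := by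
  haveI := X.barKer_normal
  haveI : (X.barKer.subgroupOf X.barTheta).Normal := X.barKer_normal.subgroupOf _
  haveI : NeZero l := ⟨by obtain ⟨k, hk⟩ := X.l_odd; omega⟩
  obtain ⟨φ, hφs, hφk⟩ := hT.quot
  obtain ⟨u, g, hu, -, hgΔ, -, hdec⟩ := X.exists_generators hT φ hφs hφk
  have hdec' : ∀ d : X.PiC, d ∈ X.DeltaX → ∃ (n : ℕ) (k : ℤ) (t : X.PiC), t ∈ X.barTheta ∧
      d = u ^ n * (g ^ k * t) := fun d hd => by
    obtain ⟨n, k, t, ht, h1, -⟩ := hdec d hd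
    exact ⟨n, k, t, ht, h1⟩
  have hzp := X.map_barTheta_eq_zpowers hΘ hu hgΔ hdec'
  let f : X.barTheta →* X.PiC ⧸ X.barKer := (QuotientGroup.mk' X.barKer).comp X.barTheta.subtype
  have hrange : f.range = X.barTheta.map (QuotientGroup.mk' X.barKer) := by
    rw [MonoidHom.range_comp, Subgroup.range_subtype]
  have hker : f.ker = X.barKer.subgroupOf X.barTheta := by
    ext t
    rw [MonoidHom.mem_ker, Subgroup.mem_subgroupOf]
    exact QuotientGroup.eq_one_iff (t : X.PiC)
  haveI : IsCyclic f.range := by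
    rw [hrange, hzp]
    infer_instance
  have hcard : Nat.card f.range = Nat.card (Multiplicative (ZMod l)) := by
    rw [hrange, X.card_map_barTheta, Nat.card_eq_fintype_card, Fintype.card_multiplicative, ZMod.card]
  exact ⟨(QuotientGroup.quotientMulEquivOfEq hker.symm).trans
    ((QuotientGroup.quotientKerEquivRange f).trans (mulEquivOfCyclicCardEq hcard))⟩

/-- The commutator `c = [u, g]` of the generators has order `l` modulo `Ker` (under `hΘ`).
[cite: MochizukiEtTh2009, Def 2.1 p.35] -/
theorem orderOf_commutator_eq (hΘ : ⁅X.DeltaX, X.DeltaX⁆ ⊔ X.barKer = X.barTheta)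
    {u g : X.PiC} (hu : u ∈ X.DeltaX) (hg : g ∈ X.DeltaX)
    (hdec : ∀ d : X.PiC, d ∈ X.DeltaX → ∃ (n : ℕ) (k : ℤ) (t : X.PiC), t ∈ X.barTheta ∧
      d = u ^ n * (g ^ k * t)) :
    haveI := X.barKer_normal
    orderOf (((⁅u, g⁆ : X.PiC) : X.PiC ⧸ X.barKer)) = l := by
  haveI := X.barKer_normal
  rw [← Nat.card_zpowers, ← X.map_barTheta_eq_zpowers hΘ hu hg hdec, X.card_map_barTheta]

/-- **Non-degeneracy of the commutator pairing** (under `hΘ : [Δ_X, Δ_X]·Ker = Δ̄_Θ`-preimage): an element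
`a ∈ Δ_X` that commutes modulo `Ker` with `Δ_{X̲} = Π_{X̲} ∩ Δ_X` (`Π_{X̲}` of type `(1, l-tors)`) lies in `Π_{X̲}`
— write `a = u^n g^k t`; then `[a, g] ≡ [u, g]^n`, and `[u, g]` has order `l`, so `l ∣ n = φ(a)`. This is
the computation behind "`Aut_K(X̲̲^log) = μ_l × {±1}`" (the normaliser of `Π_{X̲̲}` inside `Δ_X` is `Δ_{X̲}`).
[cite: MochizukiEtTh2009, Rmk 2.6.1 p.40] -/
theorem mem_of_commutator_mem_barKer (hΘ : ⁅X.DeltaX, X.DeltaX⁆ ⊔ X.barKer = X.barTheta)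
    {H : Subgroup X.PiC} (hT : X.toCoverData.IsTypeLTors H) {a : X.PiC} (ha : a ∈ X.DeltaX)
    (h : ∀ d : X.PiC, d ∈ H → d ∈ X.DeltaX → ⁅a, d⁆ ∈ X.barKer) : a ∈ H := by
  haveI := X.barKer_normal
  haveI : NeZero l := ⟨by obtain ⟨k, hk⟩ := X.l_odd; omega⟩
  obtain ⟨φ, hφs, hφk⟩ := hT.quot
  obtain ⟨u, g, hu, hgH, hgΔ, -, hdec⟩ := X.exists_generators hT φ hφs hφk
  have hdec' : ∀ d : X.PiC, d ∈ X.DeltaX → ∃ (n : ℕ) (k : ℤ) (t : X.PiC), t ∈ X.barTheta ∧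
      d = u ^ n * (g ^ k * t) := fun d hd => by
    obtain ⟨n, k, t, ht, h1, -⟩ := hdec d hd
    exact ⟨n, k, t, ht, h1⟩
  have hord := X.orderOf_commutator_eq hΘ hu hgΔ hdec'
  obtain ⟨n, k, t, ht, ha', hφa⟩ := hdec a ha
  -- `[a, g] ≡ c^n` and `[a, g] ∈ Ker`
  have hc1 : (((⁅u, g⁆ : X.PiC) : X.PiC ⧸ X.barKer)) ^ n = 1 := by
    have e := X.mk_commutator_gen_left hu hgΔ n k ht hgΔ
    rw [commutatorElement_self, QuotientGroup.mk_one, one_zpow, mul_one, ← ha'] at e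
    rw [← e, QuotientGroup.eq_one_iff]
    exact h g hgH hgΔ
  have hdvd : l ∣ n := by
    rw [← hord]
    exact orderOf_dvd_of_pow_eq_one hc1
  have : φ ⟨a, ha.1⟩ = 1 := by
    rw [hφa, (ZMod.natCast_eq_zero_iff n l).mpr hdvd, ofAdd_zero]
  exact (hφk _).mp this

end CoverDataAx

end ThetaCovers

end Literature.AnabelianGeometry.EtaleTheta
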